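import Summits.BirchSwinnertonDyer.BirchSwinnertonDyer.Theorems.AlignedTransportAtTwoMainConjectureTransportAlignedAtTwoNeronFold
import Literature.NumberTheory.EllipticCurves.ModularJacobianMultiplicityOneOfGammaOneCover
import HarnessLib

/-!
# Crux C1 `MainConjectureTransportAlignedAtTwo` (stmt-BirchSwinnertonDyer-22296), line `birth`: THE GALOIS-SIDE PRINT INPUTS IN ONE CURRENCY —
# Buzzard's Prop. 2.4 and T1 both follow from the tree's `J₁(N)`-cover fact, T1 follows from T1⁺; the `Δ > 0` residual (R1) from
# {cover, plus period unit, modularity, T1⁺}, its equal-conductor case from THREE named facts (width seat att-p4 g15; `--supports 22296`)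

THEOREMS ONLY (no `def`, no `sorry`, no new named fact). BSD is not proved by this; C1 is not closed by this; no registered stub is discharged outright —
this file only re-expresses the PRINT hypotheses of the landed (R1) capstones in the currency the tree now offers, for the next lead's stub list.

Third fold after `…SdFold` (p676260: Hecke self-duality is a theorem) and `…NeronFold` (p677162: Néron scaling is a theorem). Two observations:
(1) the tree's typed `J₁(N)`-cover fact `nonempty_modularJacobianGammaOneCover` (`Literature/…/ModularJacobianGammaOneCover.lean`: the `ℚ`-structure of
`J₀(N)` on its torsion + Eichler–Shimura + the Shimura-subgroup cover `π^* : J₀(N) → J₁(N)` with Buzzard's Lemma 2.3 and the appendix Thm. 6.1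
multiplicity one on `J₁(N)`) yields BOTH `buzzard2000_multiplicityOne_gamma0` (`buzzard2000_multiplicityOne_gamma0_of_gammaOneCover`) and T1
`nonempty_modularJacobianGaloisData` (`nonempty_modularJacobianGaloisData_of_gammaOneCover`) in the kernel; (2) T1 is also the forgetful image of T1⁺
`nonempty_modularJacobianGaloisDataWithForms` (`ModularJacobianGaloisDataWithForms.toModularJacobianGaloisData`). Hence:

* `nonempty_modularJacobianGaloisData_of_withForms` — T1 from T1⁺;
* `heckeSideAtTwo_of_cover`, `lamLawBuzzardLocus_of_cover` — the registered bundle `stub_heckeSideAtTwo` and the rhombic Buzzard-locus `λ`-law from the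
  cover fact alone;
* `lamLawDeltaPos_of_cover` — the statement of `stub_lamLawDeltaPos` (R1) VERBATIM from {cover, plus period unit at `2`, modularity, T1⁺};
* `lamLawDeltaPos_of_conductorNorm_eq_of_cover` — its equal-conductor case from THREE named facts {cover, plus period unit, modularity};
* `lamLawDeltaPos_of_conductorNorm_eq_of_withForms` — the same from {Buzzard 2.4, plus period unit, modularity, T1⁺} (no separate T1).

References: Buzzard 2000 Lemma 2.3, Prop. 2.4; Ribet–Stein/Buzzard appendix Thm. 6.1; Darmon–Diamond–Taylor 1995 §1.5–§1.7; Greenberg–Vatsal 2000 Thm. (1.4);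
Abbes–Ullmo 1996 Thm. A.
-/

noncomputable section

-- justification: the `Summit.BirchSwinnertonDyer.BirchSwinnertonDyer.…` path repeats a component (route-file convention)
set_option linter.dupNamespace false
set_option autoImplicit false

open scoped MatrixGroups ModularForm NumberField Classical
open CongruenceSubgroup Complex WeierstrassCurve IsDedekindDomain Polynomial Module
open Literature.NumberTheory.EllipticCurves Literature.NumberTheory.EllipticCurves.ModularForms
open Literature.NumberTheory.EllipticCurves.Greenberg1999 Literature.NumberTheory.EllipticCurves.GreenbergVatsal2000
open Summit.BirchSwinnertonDyer.Rank1Residual.F1Sign2 Summit.BirchSwinnertonDyer.Rank1Residual.X1.MuLambda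
open Summit.BirchSwinnertonDyer.BirchSwinnertonDyer.Theorems.AlignedTransportAtTwoSdFold
open Summit.BirchSwinnertonDyer.BirchSwinnertonDyer.Theorems.AlignedTransportAtTwoNeronFold

namespace Summit.BirchSwinnertonDyer.BirchSwinnertonDyer.Theorems.AlignedTransportAtTwoGaloisFold

/-- **T1 from T1⁺**: the `ℚ`-structure of `J₀(L)` on torsion (`nonempty_modularJacobianGaloisData`) is the forgetful image of the `ℚ`-structure with forms
(`nonempty_modularJacobianGaloisDataWithForms`). [cite: DarmonDiamondTaylor1995, §1.5 and §1.7] -/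
theorem nonempty_modularJacobianGaloisData_of_withForms (hJ : nonempty_modularJacobianGaloisDataWithForms) :
    nonempty_modularJacobianGaloisData := fun L _ ι ↦ by
  obtain ⟨J⟩ := hJ L ι
  exact ⟨J.toModularJacobianGaloisData⟩

/-- **The Hecke-side PRINT bundle of the C1 line from the `J₁(N)`-cover fact alone**: the TYPE of the registered stub `stub_heckeSideAtTwo`
(`heckeSelfDual_torsionBy_J0 ∧ buzzard2000_multiplicityOne_gamma0`) — self-duality is a tree theorem (`…SdFold`), Buzzard's Prop. 2.4 is
`buzzard2000_multiplicityOne_gamma0_of_gammaOneCover`. [cite: Buzzard2000LevelLoweringModTwo, Lemma 2.3 and Prop. 2.4] [cite: RibetStein2008, Thm. 6.1] -/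
theorem heckeSideAtTwo_of_cover (hΓ : nonempty_modularJacobianGammaOneCover) :
    heckeSelfDual_torsionBy_J0 ∧ buzzard2000_multiplicityOne_gamma0 :=
  heckeSideAtTwo_of_bz (buzzard2000_multiplicityOne_gamma0_of_gammaOneCover hΓ)

/-- **The `λ`-law on the rhombic Buzzard locus (`Δ(W₁) < 0`, `Δ(W₁) ∉ ℚ₂²`) from the `J₁(N)`-cover fact ALONE** (`…SdFold.lamLawBuzzardLocus_of_bz` with
Buzzard's Prop. 2.4 supplied by `buzzard2000_multiplicityOne_gamma0_of_gammaOneCover`), in the binder shape of the skeleton's `lamLawBuzzardLocus_of_stubs`.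
[cite: Buzzard2000LevelLoweringModTwo, Prop. 2.4] [cite: GreenbergVatsal2000, Thm. (1.4) and §3] -/
theorem lamLawBuzzardLocus_of_cover (hΓ : nonempty_modularJacobianGammaOneCover) :
    ∀ (W₁ : WeierstrassCurve ℚ) [W₁.IsElliptic] [W₁.IsGloballyMinimal]
      (W₂ : WeierstrassCurve ℚ) [W₂.IsElliptic] [W₂.IsGloballyMinimal],
      IsOrdinaryAt W₁ 2 → IsOrdinaryAt W₂ 2 →
      (∀ x : ℚ, ¬ HasRationalTwoTorsionX W₁ x) → (∀ x : ℚ, ¬ HasRationalTwoTorsionX W₂ x) →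
      ¬ IsSquare W₁.Δ → ¬ IsSquare W₂.Δ →
      (¬ ∃ (d : ℚ) (c : WeierstrassCurve.VariableChange ℚ), c • W₁.quadraticTwist d = W₂) →
      W₁.Δ < 0 → (∀ s : ℚ_[2], s ^ 2 ≠ (W₁.Δ : ℚ_[2])) →
      ∀ (F : Type) [Field F] [NumberField F], Module.finrank ℚ F = 3 →
      ∀ e₁ e₂ : F, aeval e₁ (twoDivisionUCubic W₁) = 0 → aeval e₂ (twoDivisionUCubic W₂) = 0 →
      AlignedAtTwo F e₁ e₂ → AlignedAtInfinity F (twoDivisionUCubic W₁) (twoDivisionUCubic W₂) e₁ e₂ →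
      ∀ [NeZero (W₁.conductorNorm ℤ)] [NeZero (W₂.conductorNorm ℤ)]
        (f₁ : CuspForm (Gamma0 (W₁.conductorNorm ℤ)) 2), IsNewformOf W₁ f₁ →
      ∀ (f₂ : CuspForm (Gamma0 (W₂.conductorNorm ℤ)) 2), IsNewformOf W₂ f₂ →
      ∀ G₁ G₂ : IwasawaAlgebra 2, IsEvenBranchLiftAtTwo W₁ f₁ G₁ → IsEvenBranchLiftAtTwo W₂ f₂ G₂ →
        lam G₁ + ∑ ℓ ∈ (W₁.conductorNorm ℤ * W₂.conductorNorm ℤ).primeFactors.erase 2, lambdaCorrectionAtTwo W₁ ℓ =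
          lam G₂ + ∑ ℓ ∈ (W₁.conductorNorm ℤ * W₂.conductorNorm ℤ).primeFactors.erase 2, lambdaCorrectionAtTwo W₂ ℓ :=
  lamLawBuzzardLocus_of_bz (buzzard2000_multiplicityOne_gamma0_of_gammaOneCover hΓ)

/-- **(R1) `stub_lamLawDeltaPos` — its statement VERBATIM — from {`J₁(N)`-cover, plus period unit at `2`, modularity, T1⁺}**
(`…NeronFold.lamLawDeltaPos_of_four_facts` with Buzzard's Prop. 2.4 supplied by the cover fact). [cite: GreenbergVatsal2000, Thm. (1.4) and §3]
[cite: Buzzard2000LevelLoweringModTwo, Prop. 2.4] [cite: DarmonDiamondTaylor1995, §1.5 and §1.7] [cite: AbbesUllmo1996, Thm. A] -/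
theorem lamLawDeltaPos_of_cover
    (hΓ : nonempty_modularJacobianGammaOneCover) (hΩu : realPeriodRat_eq_unit_mul_plusPeriod_two)
    (hmod : exists_isNewformOf) (hJ : nonempty_modularJacobianGaloisDataWithForms) :
    ∀ (W₁ : WeierstrassCurve ℚ) [W₁.IsElliptic] [W₁.IsGloballyMinimal]
      (W₂ : WeierstrassCurve ℚ) [W₂.IsElliptic] [W₂.IsGloballyMinimal],
      IsOrdinaryAt W₁ 2 → IsOrdinaryAt W₂ 2 →
      (∀ x : ℚ, ¬ HasRationalTwoTorsionX W₁ x) → (∀ x : ℚ, ¬ HasRationalTwoTorsionX W₂ x) →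
      ¬ IsSquare W₁.Δ → ¬ IsSquare W₂.Δ →
      (¬ ∃ (d : ℚ) (c : WeierstrassCurve.VariableChange ℚ), c • W₁.quadraticTwist d = W₂) →
      ¬ OnKilfordStratumAtTwo W₁ → 0 < W₁.Δ →
      ∀ (F : Type) [Field F] [NumberField F], Module.finrank ℚ F = 3 →
      ∀ e₁ e₂ : F, aeval e₁ (twoDivisionUCubic W₁) = 0 → aeval e₂ (twoDivisionUCubic W₂) = 0 →
      AlignedAtTwo F e₁ e₂ → AlignedAtInfinity F (twoDivisionUCubic W₁) (twoDivisionUCubic W₂) e₁ e₂ →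
      ∀ [NeZero (W₁.conductorNorm ℤ)] [NeZero (W₂.conductorNorm ℤ)]
        (f₁ : CuspForm (Gamma0 (W₁.conductorNorm ℤ)) 2), IsNewformOf W₁ f₁ →
      ∀ (f₂ : CuspForm (Gamma0 (W₂.conductorNorm ℤ)) 2), IsNewformOf W₂ f₂ →
      ∀ G₁ G₂ : IwasawaAlgebra 2, IsEvenBranchLiftAtTwo W₁ f₁ G₁ → IsEvenBranchLiftAtTwo W₂ f₂ G₂ →
        lam G₁ + ∑ ℓ ∈ (W₁.conductorNorm ℤ * W₂.conductorNorm ℤ).primeFactors.erase 2, lambdaCorrectionAtTwo W₁ ℓ =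
          lam G₂ + ∑ ℓ ∈ (W₁.conductorNorm ℤ * W₂.conductorNorm ℤ).primeFactors.erase 2, lambdaCorrectionAtTwo W₂ ℓ :=
  lamLawDeltaPos_of_four_facts (buzzard2000_multiplicityOne_gamma0_of_gammaOneCover hΓ) hΩu hmod hJ

/-- **The equal-conductor case of (R1) from THREE named facts** {`J₁(N)`-cover (⟹ Buzzard 2.4 and T1), plus period unit at `2`, modularity}
(`…NeronFold.lamLawDeltaPos_of_conductorNorm_eq_of_four_facts`). Conclusion = that of `stub_lamLawDeltaPos`.
[cite: GreenbergVatsal2000, Thm. (1.4)] [cite: Buzzard2000LevelLoweringModTwo, Prop. 2.4] [cite: DarmonDiamondTaylor1995, §1.5 and §1.7] -/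
theorem lamLawDeltaPos_of_conductorNorm_eq_of_cover
    (hΓ : nonempty_modularJacobianGammaOneCover) (hΩu : realPeriodRat_eq_unit_mul_plusPeriod_two) (hmod : exists_isNewformOf)
    (ι : AlgebraicClosure ℚ →+* ℂ)
    (W₁ : WeierstrassCurve ℚ) [W₁.IsElliptic] [W₁.IsGloballyMinimal]
    (W₂ : WeierstrassCurve ℚ) [W₂.IsElliptic] [W₂.IsGloballyMinimal]
    (hord₁ : IsOrdinaryAt W₁ 2) (hord₂ : IsOrdinaryAt W₂ 2)
    (ht₁ : ∀ x : ℚ, ¬ HasRationalTwoTorsionX W₁ x) (ht₂ : ∀ x : ℚ, ¬ HasRationalTwoTorsionX W₂ x)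
    (hsq₂ : ¬ IsSquare W₂.Δ) (hK : ¬ OnKilfordStratumAtTwo W₁) (hΔ : 0 < W₁.Δ)
    {F : Type} [Field F] [NumberField F] (hF : finrank ℚ F = 3)
    {e₁ e₂ : F} (he₁ : aeval e₁ (twoDivisionUCubic W₁) = 0) (he₂ : aeval e₂ (twoDivisionUCubic W₂) = 0)
    (hal : AlignedAtInfinity F (twoDivisionUCubic W₁) (twoDivisionUCubic W₂) e₁ e₂)
    [NeZero (W₁.conductorNorm ℤ)] [NeZero (W₂.conductorNorm ℤ)]
    {f₁ : CuspForm (Gamma0 (W₁.conductorNorm ℤ)) 2} (hf₁ : IsNewformOf W₁ f₁)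
    {f₂ : CuspForm (Gamma0 (W₂.conductorNorm ℤ)) 2} (hf₂ : IsNewformOf W₂ f₂)
    {G₁ G₂ : IwasawaAlgebra 2} (hG₁ : IsEvenBranchLiftAtTwo W₁ f₁ G₁) (hG₂ : IsEvenBranchLiftAtTwo W₂ f₂ G₂)
    (hN : W₁.conductorNorm ℤ = W₂.conductorNorm ℤ) :
    lam G₁ + ∑ ℓ ∈ (W₁.conductorNorm ℤ * W₂.conductorNorm ℤ).primeFactors.erase 2, lambdaCorrectionAtTwo W₁ ℓ =
      lam G₂ + ∑ ℓ ∈ (W₁.conductorNorm ℤ * W₂.conductorNorm ℤ).primeFactors.erase 2, lambdaCorrectionAtTwo W₂ ℓ :=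
  lamLawDeltaPos_of_conductorNorm_eq_of_four_facts (buzzard2000_multiplicityOne_gamma0_of_gammaOneCover hΓ) hΩu hmod
    (nonempty_modularJacobianGaloisData_of_gammaOneCover hΓ) ι W₁ W₂ hord₁ hord₂ ht₁ ht₂ hsq₂ hK hΔ hF he₁ he₂ hal hf₁ hf₂ hG₁ hG₂ hN

/-- **The equal-conductor case of (R1) from {Buzzard 2.4, plus period unit, modularity, T1⁺}** — T1 supplied by the forgetful map from T1⁺, so the
equal-conductor road needs no Galois-side fact beyond those of the general road. Conclusion = that of `stub_lamLawDeltaPos`.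
[cite: GreenbergVatsal2000, Thm. (1.4)] [cite: Buzzard2000LevelLoweringModTwo, Prop. 2.4] [cite: DarmonDiamondTaylor1995, §1.5 and §1.7] -/
theorem lamLawDeltaPos_of_conductorNorm_eq_of_withForms
    (hBz : buzzard2000_multiplicityOne_gamma0) (hΩu : realPeriodRat_eq_unit_mul_plusPeriod_two) (hmod : exists_isNewformOf)
    (hJ : nonempty_modularJacobianGaloisDataWithForms) (ι : AlgebraicClosure ℚ →+* ℂ)
    (W₁ : WeierstrassCurve ℚ) [W₁.IsElliptic] [W₁.IsGloballyMinimal]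
    (W₂ : WeierstrassCurve ℚ) [W₂.IsElliptic] [W₂.IsGloballyMinimal]
    (hord₁ : IsOrdinaryAt W₁ 2) (hord₂ : IsOrdinaryAt W₂ 2)
    (ht₁ : ∀ x : ℚ, ¬ HasRationalTwoTorsionX W₁ x) (ht₂ : ∀ x : ℚ, ¬ HasRationalTwoTorsionX W₂ x)
    (hsq₂ : ¬ IsSquare W₂.Δ) (hK : ¬ OnKilfordStratumAtTwo W₁) (hΔ : 0 < W₁.Δ)
    {F : Type} [Field F] [NumberField F] (hF : finrank ℚ F = 3)
    {e₁ e₂ : F} (he₁ : aeval e₁ (twoDivisionUCubic W₁) = 0) (he₂ : aeval e₂ (twoDivisionUCubic W₂) = 0)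
    (hal : AlignedAtInfinity F (twoDivisionUCubic W₁) (twoDivisionUCubic W₂) e₁ e₂)
    [NeZero (W₁.conductorNorm ℤ)] [NeZero (W₂.conductorNorm ℤ)]
    {f₁ : CuspForm (Gamma0 (W₁.conductorNorm ℤ)) 2} (hf₁ : IsNewformOf W₁ f₁)
    {f₂ : CuspForm (Gamma0 (W₂.conductorNorm ℤ)) 2} (hf₂ : IsNewformOf W₂ f₂)
    {G₁ G₂ : IwasawaAlgebra 2} (hG₁ : IsEvenBranchLiftAtTwo W₁ f₁ G₁) (hG₂ : IsEvenBranchLiftAtTwo W₂ f₂ G₂)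
    (hN : W₁.conductorNorm ℤ = W₂.conductorNorm ℤ) :
    lam G₁ + ∑ ℓ ∈ (W₁.conductorNorm ℤ * W₂.conductorNorm ℤ).primeFactors.erase 2, lambdaCorrectionAtTwo W₁ ℓ =
      lam G₂ + ∑ ℓ ∈ (W₁.conductorNorm ℤ * W₂.conductorNorm ℤ).primeFactors.erase 2, lambdaCorrectionAtTwo W₂ ℓ :=
  lamLawDeltaPos_of_conductorNorm_eq_of_four_facts hBz hΩu hmod (nonempty_modularJacobianGaloisData_of_withForms hJ) ι W₁ W₂ hord₁ hord₂ ht₁ ht₂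
    hsq₂ hK hΔ hF he₁ he₂ hal hf₁ hf₂ hG₁ hG₂ hN

end Summit.BirchSwinnertonDyer.BirchSwinnertonDyer.Theorems.AlignedTransportAtTwoGaloisFold

end
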